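import Summits.BirchSwinnertonDyer.BirchSwinnertonDyer.Theorems.KolyvaginRankRigidityAtTwoKolyvaginBoundedDefectAtTwoDepthZero
import HarnessLib

/-!
# Corank-one collapse — typed sketch (pen bsd-idea-1 g19; crux U1 = stmt-BirchSwinnertonDyer-28083)

`KolyvaginBoundedDefectAtTwoCorankOne` = U1 restricted to the frames where the 2∞-Selmer corank of `E/K`
(booked as `corank(E/ℚ) + corank(E^{(D_K)}/ℚ)`, the form `closes` of route KRR produces them in) equals `1`;
`HeegnerNonTorsionAtTwoCorankOne` = «`P(1) = y_K` has infinite order on those frames» (the 2-converse over `K`).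
Checked here: `HeegnerNonTorsionAtTwoCorankOne → KolyvaginBoundedDefectAtTwoCorankOne` (by the landed depth-zero rung
`KolyvaginAtTwo.boundedDefectAtTwo_of_nonTorsion`, r = 0 — no twist, no congruence, no prime swap) and the trivial
weakening `KolyvaginBoundedDefectAtTwo → KolyvaginBoundedDefectAtTwoCorankOne`.
v2 (same session): the other half is now CHECKED too — `closes_of_corankOne` replays KRR's deciding theorem verbatim with
`hV1` weakened to the corank-one restriction `KolyvaginStrongNonzeroSystemAtTwoCorankOne` (the two `hV1` call sites pass the
booked corank equation), `strongCorankOne_of_boundedDefectCorankOne` is LINE 14's glue restricted, and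
`nonCMTwoConverse_of_heegnerNonTorsionCorankOne` is the end-to-end statement: the 2-converse over K on corank-one frames
(`HeegnerNonTorsionAtTwoCorankOne`) + U2 (`FullClassDeepeningAtTwo`, landed modulo Gross Prop. 3.7(2)) + the route's other
hypotheses ⟹ the leaf `Rank1Residual.NonCMTwoConverse`. So for `closes`, U1 may be replaced by its corank-one restriction,
which is implied AT DEPTH 0 by y_K non-torsion. Nothing here proves U1, the 2-converse, a rung, or BSD: every theorem below is
an implication between OPEN statements (plus print-fact hypotheses).
-/

set_option linter.dupNamespace false

open scoped Classical

namespace Summit.BirchSwinnertonDyer.BirchSwinnertonDyer.Cruxes.KolyvaginBoundedDefectAtTwo.CorankOneCollapse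

open WeierstrassCurve Field Literature.NumberTheory.EllipticCurves

/-- U1 (`KolyvaginBoundedDefectAtTwo`) restricted to the corank-one frames: same binders plus the hypothesis
`W.selmerCorank 2 + (W.quadraticTwist D_K).selmerCorank 2 = 1`. -/
def KolyvaginBoundedDefectAtTwoCorankOne : Prop :=
  ∀ (W : WeierstrassCurve ℚ) [W.IsElliptic] [W.IsGloballyMinimal], ¬ W.HasCM →
    (Rank1Residual.GoodOrd W 2 ∨ Rank1Residual.Mult W 2) →
    (∀ m : ℕ, W.HasSurjectiveModNGaloisRep (2 ^ m : ℕ)) →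
    ∀ (K : Type) [Field K] [NumberField K], IsImaginaryQuadratic K →
    ∀ [NeZero (W.conductorNorm ℤ)],
    SatisfiesHeegnerHypothesis (W.conductorNorm ℤ) K →
    Odd (NumberField.discr K) → NumberField.discr K ≠ -3 →
    AddSubgroup.torsionBy (W.baseChange K).toAffine.Point (2 : ℤ) = ⊥ →
    SatisfiesHeegnerHypothesis 2 K →
    ∀ (Dt : ModularForms.ModularParametrizationData W (W.conductorNorm ℤ)) (β : ℤ) (ι : K →+* ℂ),
      (4 * (W.conductorNorm ℤ : ℤ)) ∣ β ^ 2 - NumberField.discr K →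
    ∀ [(W.quadraticTwist (NumberField.discr K : ℚ)).IsElliptic],
      W.selmerCorank 2 + (W.quadraticTwist (NumberField.discr K : ℚ)).selmerCorank 2 = 1 →
    ∃ r m : ℕ, ∀ M : ℕ, m < M →
      ∃ (n : ℕ) (d : KolyvaginHeegnerData Dt β ι n),
        KolyvaginDescent.KolSupp (Zhang2014.IsKolyvaginPrime (W.conductorNorm ℤ) W K 2) n ∧
        n.primeFactors.card = r ∧
        ((M : ℕ) : ℕ∞) ≤ Zhang2014.levelIndex W 2 n ∧
        (2 ^ (M - m - 1) : ℤ) • d.kolyvaginClass Nat.prime_two M ≠ 0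

/-- The 2-converse over `K` on the corank-one frames, in U1's currency: `P(1)` has infinite order. -/
def HeegnerNonTorsionAtTwoCorankOne : Prop :=
  ∀ (W : WeierstrassCurve ℚ) [W.IsElliptic] [W.IsGloballyMinimal], ¬ W.HasCM →
    (Rank1Residual.GoodOrd W 2 ∨ Rank1Residual.Mult W 2) →
    (∀ m : ℕ, W.HasSurjectiveModNGaloisRep (2 ^ m : ℕ)) →
    ∀ (K : Type) [Field K] [NumberField K], IsImaginaryQuadratic K →
    ∀ [NeZero (W.conductorNorm ℤ)],
    SatisfiesHeegnerHypothesis (W.conductorNorm ℤ) K →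
    Odd (NumberField.discr K) → NumberField.discr K ≠ -3 →
    AddSubgroup.torsionBy (W.baseChange K).toAffine.Point (2 : ℤ) = ⊥ →
    SatisfiesHeegnerHypothesis 2 K →
    ∀ (Dt : ModularForms.ModularParametrizationData W (W.conductorNorm ℤ)) (β : ℤ) (ι : K →+* ℂ),
      (4 * (W.conductorNorm ℤ : ℤ)) ∣ β ^ 2 - NumberField.discr K →
    ∀ [(W.quadraticTwist (NumberField.discr K : ℚ)).IsElliptic],
      W.selmerCorank 2 + (W.quadraticTwist (NumberField.discr K : ℚ)).selmerCorank 2 = 1 →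
    ∃ d₁ : KolyvaginHeegnerData Dt β ι 1, ¬ IsOfFinAddOrder d₁.derivedPoint

/-- Trivial weakening: U1 implies its corank-one restriction. -/
theorem corankOne_of_boundedDefect
    (hU1 : Summit.BirchSwinnertonDyer.BirchSwinnertonDyer.Theses.KolyvaginRankRigidityAtTwo.KolyvaginBoundedDefectAtTwo) :
    KolyvaginBoundedDefectAtTwoCorankOne :=
  fun W _ _ hCM hred hsur K _ _ hK _ hHN hodd hne3 htor hH2 Dt β ι hβ _ _ ↦
    hU1 W hCM hred hsur K hK hHN hodd hne3 htor hH2 Dt β ι hβ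

/-- **Corank-one collapse (the checked half).** On the corank-one frames U1 follows from the non-torsion of `P(1)` AT DEPTH
`r = 0`, by the landed rung `KolyvaginAtTwo.boundedDefectAtTwo_of_nonTorsion`. -/
theorem corankOne_of_heegnerNonTorsion (h : HeegnerNonTorsionAtTwoCorankOne) :
    KolyvaginBoundedDefectAtTwoCorankOne :=
  fun W _ _ hCM hred hsur K _ _ hK _ hHN hodd hne3 htor hH2 Dt β ι hβ _ hc ↦
    Summit.BirchSwinnertonDyer.BirchSwinnertonDyer.Theorems.KolyvaginAtTwo.boundedDefectAtTwo_of_nonTorsion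
      W hCM hred hsur K hK hHN hodd hne3 htor hH2 Dt β ι hβ
      (h W hCM hred hsur K hK hHN hodd hne3 htor hH2 Dt β ι hβ hc)


/-- V1′∞ (`KolyvaginStrongNonzeroSystemAtTwo`) restricted to the corank-one frames. -/
def KolyvaginStrongNonzeroSystemAtTwoCorankOne : Prop :=
  ∀ (W : WeierstrassCurve ℚ) [W.IsElliptic] [W.IsGloballyMinimal], ¬ W.HasCM → (Literature.NumberTheory.EllipticCurves.Rank1Residual.GoodOrd W 2 ∨ Literature.NumberTheory.EllipticCurves.Rank1Residual.Mult W 2) → (∀ m : ℕ, W.HasSurjectiveModNGaloisRep (2 ^ m : ℕ)) → ∀ (K : Type) [Field K] [NumberField K], Literature.NumberTheory.EllipticCurves.IsImaginaryQuadratic K → ∀ [NeZero (W.conductorNorm ℤ)], Literature.NumberTheory.EllipticCurves.SatisfiesHeegnerHypothesis (W.conductorNorm ℤ) K → Odd (NumberField.discr K) → NumberField.discr K ≠ -3 → AddSubgroup.torsionBy (W.baseChange K).toAffine.Point (2 : ℤ) = ⊥ → Literature.NumberTheory.EllipticCurves.SatisfiesHeegnerHypothesis 2 K → ∀ (Dt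 : Literature.NumberTheory.EllipticCurves.ModularForms.ModularParametrizationData W (W.conductorNorm ℤ)) (β : ℤ) (ι : K →+* ℂ), (4 * (W.conductorNorm ℤ : ℤ)) ∣ β ^ 2 - NumberField.discr K →
    ∀ [(W.quadraticTwist (NumberField.discr K : ℚ)).IsElliptic],
      W.selmerCorank 2 + (W.quadraticTwist (NumberField.discr K : ℚ)).selmerCorank 2 = 1 →
    ∃ r : ℕ, ∀ θ k : ℕ, ∃ (n : ℕ) (d : Literature.NumberTheory.EllipticCurves.KolyvaginHeegnerData Dt β ι n) (M : ℕ), Literature.NumberTheory.EllipticCurves.KolyvaginDescent.KolSupp (Literature.NumberTheory.EllipticCurves.Zhang2014.IsKolyvaginPrime (W.conductorNorm ℤ) W K 2) n ∧ n.primeFactors.card = r ∧ 1 ≤ M ∧ ((θ * M + k : ℕ) : ℕ∞) ≤ Literature.NumberTheory.EllipticCurves.Zhang2014.levelIndex W 2 n ∧ d.kolyvaginClass Nat.prime_two M ≠ 0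

/-- LINE 14's glue restricted to corank-one frames (same 6-line proof as
`KolyvaginRigidity.strongNonzeroSystemOfSeedTransport_proof`, level `M := c·(m+r+1)+m+1`). -/
theorem strongCorankOne_of_boundedDefectCorankOne (h₁ : KolyvaginBoundedDefectAtTwoCorankOne)
    (h₂ : Summit.BirchSwinnertonDyer.BirchSwinnertonDyer.Theses.KolyvaginRankRigidityAtTwo.FullClassDeepeningAtTwo) :
    KolyvaginStrongNonzeroSystemAtTwoCorankOne := by
  intro W _ _ hCM hred hsur K _ _ hK _ hHN hodd hne3 htor hH2 Dt β ι hβ _ hcork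
  obtain ⟨c, hc⟩ := h₂ W hCM hred hsur K hK hHN hodd hne3 htor hH2 Dt β ι hβ
  obtain ⟨r, m, hrm⟩ := h₁ W hCM hred hsur K hK hHN hodd hne3 htor hH2 Dt β ι hβ hcork
  refine ⟨r, fun θ k ↦ ?_⟩
  obtain ⟨n, d, hn, hr, hlev, hne⟩ := hrm (c * (m + r + 1) + m + 1) (by omega)
  exact hc θ k r m (c * (m + r + 1) + m + 1) n d hn hr hlev (by omega) hne

section ClosesReplay

open scoped BigOperators Topology
open Summit.BirchSwinnertonDyer.BirchSwinnertonDyer.Theses.KolyvaginRankRigidityAtTwo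
open Literature

/-- **KRR's deciding theorem needs V1 only on the corank-one frames.** Verbatim replay of
`Theses.KolyvaginRankRigidityAtTwo.closes` (rev 35, l.738–898) with `hV1 : KolyvaginStrongNonzeroSystemAtTwo` weakened to
its corank-one restriction; the only edits are the two `hV1` call sites, which now also pass the booked corank equation
(`0 + 1 = 1` in the `r = 0` branch, `1 + 0 = 1` in the `r = 1` branch). -/
theorem closes_of_corankOne (hV1 : KolyvaginStrongNonzeroSystemAtTwoCorankOne)
    (hV2 : KolyvaginCorankLowerBoundAtTwoRich)
    (hR : OffHabitatNonSurjTwoConverse) (hIn : PrintedInputsRankOneAtTwo) (hT : NoTwoTorsionOverK)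
    (hf : BFHTwistSupply) (h0 : SimpleZeroTwistSplitAtTwoOfBFH) (hGZK : MultPublishedInputsAtTwo)
    (hMod : NewformOfEllipticCurve) (hHLT : HoffsteinLuoNonvanishingTwist) (hEnt : EntireLFunctionRat) :
    Summit.BirchSwinnertonDyer.BirchSwinnertonDyer.Rank1Residual.NonCMTwoConverse := by
  have hBFH : SimpleZeroTwistSplitAtTwo := h0 hf
  intro W _ _ hCM hred r hr hc
  by_cases hsur : (∀ m : ℕ, W.HasSurjectiveModNGaloisRep (2 ^ m : ℕ))
  swap
  · exact hR W hCM hred r hr hc hsur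
  obtain ⟨-, -, hpar, hKato, -, hGZ, hrec⟩ := hIn
  have hmod : Literature.NumberTheory.EllipticCurves.ModularForms.exists_isNewformOf := hMod
  have hHL : Literature.NumberTheory.EllipticCurves.HoffsteinLuo1997_exists_twist_L_one_ne_zero := hHLT
  have hE : WeierstrassCurve.hasEntireLFunction_rat := hEnt
  have hGZK' : Literature.NumberTheory.EllipticCurves.rank_eq_analyticRank_of_analyticRank_le_one := hGZK
  haveI : Fact (Nat.Prime 2) := ⟨Nat.prime_two⟩
  haveI : NeZero (W.conductorNorm ℤ) := ⟨(W.conductorNorm_pos_holds).ne'⟩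
  obtain rfl | rfl : r = 0 ∨ r = 1 := by omega
  · -- ===== r = 0 : partner twist with a simple zero (BFH 1990 (i), `2` split) =====
    have hw : W.rootNumber = 1 := by
      have h := hpar W
      unfold Literature.NumberTheory.EllipticCurves.p_parity at h
      rw [hc, pow_zero] at h
      exact h.symm
    obtain ⟨K, _, _, hK, -, hHN, hH2, hd8, hL0, hL1⟩ := hBFH W hw 0
    have hodd : Odd (NumberField.discr K) := by
      rw [Int.odd_iff]; omega
    have hne3 : NumberField.discr K ≠ -3 := by omega
    have hne4 : NumberField.discr K ≠ -4 := by omega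
    have h2d : ¬ ((2 : ℤ) ∣ NumberField.discr K) := by omega
    have hd : (NumberField.discr K : ℚ) ≠ 0 := by exact_mod_cast NumberField.discr_ne_zero K
    haveI := W.isElliptic_quadraticTwist hd
    have hr1 : (W.quadraticTwist (NumberField.discr K : ℚ)).analyticRank = 1 :=
      Literature.NumberTheory.EllipticCurves.analyticRank_eq_one_of_entireLFunction_one_eq_zero_of_deriv_ne_zero
        _ (hE _) hL0 hL1
    obtain ⟨hrk, hsha⟩ := hGZK' (W.quadraticTwist (NumberField.discr K : ℚ)) (le_of_eq hr1)
    rw [hr1] at hrk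
    haveI := hsha
    have hc' : (W.quadraticTwist (NumberField.discr K : ℚ)).selmerCorank 2 = 1 :=
      Literature.NumberTheory.EllipticCurves.selmerCorank_eq_one_of_mordellWeilRank_eq_one_of_finite
        (W.quadraticTwist (NumberField.discr K : ℚ)) 2 hrk inferInstance
    have htor := hT W hsur K hK
    obtain ⟨fW, hfW⟩ := hMod W
    obtain ⟨Dt⟩ :=
      Literature.NumberTheory.Automorphic.nonempty_modularParametrizationData_of_isNewformOf hfW
    obtain ⟨β, hβ⟩ := Literature.NumberTheory.EllipticCurves.exists_dvd_sq_sub_discr_holds (W.conductorNorm ℤ) K hK hHN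
    obtain ⟨ι⟩ := (inferInstance : Nonempty (K →+* ℂ))
    obtain ⟨r, hr⟩ := hV1 W hCM hred hsur K hK hHN hodd hne3 htor hH2 Dt β ι hβ (by rw [hc, hc'])
    -- the least RICH depth `ν ≤ r`
    have hex : ∃ ν : ℕ, ∀ θ k : ℕ, ∃ (n : ℕ)
        (d : Literature.NumberTheory.EllipticCurves.KolyvaginHeegnerData Dt β ι n) (M : ℕ),
        Literature.NumberTheory.EllipticCurves.KolyvaginDescent.KolSupp
          (Literature.NumberTheory.EllipticCurves.Zhang2014.IsKolyvaginPrime (W.conductorNorm ℤ) W K 2) n ∧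
        n.primeFactors.card = ν ∧ 1 ≤ M ∧
        ((θ * M + k : ℕ) : ℕ∞) ≤ Literature.NumberTheory.EllipticCurves.Zhang2014.levelIndex W 2 n ∧
        d.kolyvaginClass Nat.prime_two M ≠ 0 := ⟨r, hr⟩
    have hrich := Nat.find_spec hex
    have hbelow : ∀ ν' : ℕ, ν' < Nat.find hex → ∃ θ k : ℕ, ∀ (n' : ℕ)
        (d' : Literature.NumberTheory.EllipticCurves.KolyvaginHeegnerData Dt β ι n') (M' : ℕ),
        Literature.NumberTheory.EllipticCurves.KolyvaginDescent.KolSupp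
          (Literature.NumberTheory.EllipticCurves.Zhang2014.IsKolyvaginPrime (W.conductorNorm ℤ) W K 2) n' →
        1 ≤ M' →
        ((θ * M' + k : ℕ) : ℕ∞) ≤ Literature.NumberTheory.EllipticCurves.Zhang2014.levelIndex W 2 n' →
        n'.primeFactors.card = ν' → d'.kolyvaginClass Nat.prime_two M' = 0 := by
      intro ν' hν'
      have h := Nat.find_min hex hν'
      rw [not_forall] at h
      obtain ⟨θ, h⟩ := h
      rw [not_forall] at h
      obtain ⟨k, hθk⟩ := h
      exact ⟨θ, k, fun n' d' M' hn' hM' hle hcard ↦ by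
        by_contra hne'; exact hθk ⟨n', d', M', hn', hcard, hM', hle, hne'⟩⟩
    -- the ONLY use of V2: the lower bound `ν + 1 ≤ max(c, c') = 1` forces `ν = 0`
    have hstruct := hV2 W hCM hred hsur K hK hne3 hne4 h2d hHN Dt β ι (Nat.find hex) hrich hbelow
    have hν : Nat.find hex = 0 := by
      rcases hstruct with h1 | h1 <;> omega
    rw [hν] at hrich
    obtain ⟨n₀, d₀, M₀, hn₀, hν0, hM₀, -, hne₀⟩ := hrich 0 0
    have hn1 : n₀ = 1 := by
      rw [Finset.card_eq_zero, Nat.primeFactors_eq_empty] at hν0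
      rcases hν0 with h0 | h1
      · exact absurd (h0 ▸ hn₀.1) not_squarefree_zero
      · exact h1
    subst hn1
    have hEK : Literature.NumberTheory.EllipticCurves.analyticRankEK W K = 1 :=
      Literature.NumberTheory.EllipticCurves.heegnerSystem_analyticRankEK_eq_one_of_kolyvaginClass_one_ne_zero
        (hGZ W _ K) (hrec _ W K) hK rfl hHN d₀ hne₀
    rw [Literature.NumberTheory.EllipticCurves.analyticRankEK_eq_add_of hE W K, hr1] at hEK
    omega
  · -- ===== r = 1 : partner twist with L(E^{(d_K)}, 1) ≠ 0 (Hoffstein–Luo) =====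
    have hw : W.rootNumber = -1 := by
      have h := hpar W
      unfold Literature.NumberTheory.EllipticCurves.p_parity at h
      rw [hc, pow_one] at h
      exact h.symm
    obtain ⟨K, _, _, hK, -, hHN, hH2, hd8, hL1⟩ :=
      Literature.NumberTheory.EllipticCurves.exists_heegnerField_split_twist_ne_zero_discr_emod_eight_of_hoffsteinLuo
        hmod hHL W hw Nat.prime_two 0
    have hodd : Odd (NumberField.discr K) := by
      rw [Int.odd_iff]; omega
    have hne3 : NumberField.discr K ≠ -3 := by omega
    have hne4 : NumberField.discr K ≠ -4 := by omega
    have h2d : ¬ ((2 : ℤ) ∣ NumberField.discr K) := by omega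
    have hd : (NumberField.discr K : ℚ) ≠ 0 := by exact_mod_cast NumberField.discr_ne_zero K
    haveI := W.isElliptic_quadraticTwist hd
    obtain ⟨-, -, hfin⟩ := hKato (W.quadraticTwist (NumberField.discr K : ℚ)) hL1
    haveI := hfin
    have hc' : (W.quadraticTwist (NumberField.discr K : ℚ)).selmerCorank 2 = 0 :=
      (W.quadraticTwist (NumberField.discr K : ℚ)).selmerCorank_eq_zero_of_finite 2
    have htor := hT W hsur K hK
    obtain ⟨fW, hfW⟩ := hMod W
    obtain ⟨Dt⟩ :=
      Literature.NumberTheory.Automorphic.nonempty_modularParametrizationData_of_isNewformOf hfW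
    obtain ⟨β, hβ⟩ := Literature.NumberTheory.EllipticCurves.exists_dvd_sq_sub_discr_holds (W.conductorNorm ℤ) K hK hHN
    obtain ⟨ι⟩ := (inferInstance : Nonempty (K →+* ℂ))
    obtain ⟨r, hr⟩ := hV1 W hCM hred hsur K hK hHN hodd hne3 htor hH2 Dt β ι hβ (by rw [hc, hc'])
    -- the least RICH depth `ν ≤ r`
    have hex : ∃ ν : ℕ, ∀ θ k : ℕ, ∃ (n : ℕ)
        (d : Literature.NumberTheory.EllipticCurves.KolyvaginHeegnerData Dt β ι n) (M : ℕ),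
        Literature.NumberTheory.EllipticCurves.KolyvaginDescent.KolSupp
          (Literature.NumberTheory.EllipticCurves.Zhang2014.IsKolyvaginPrime (W.conductorNorm ℤ) W K 2) n ∧
        n.primeFactors.card = ν ∧ 1 ≤ M ∧
        ((θ * M + k : ℕ) : ℕ∞) ≤ Literature.NumberTheory.EllipticCurves.Zhang2014.levelIndex W 2 n ∧
        d.kolyvaginClass Nat.prime_two M ≠ 0 := ⟨r, hr⟩
    have hrich := Nat.find_spec hex
    have hbelow : ∀ ν' : ℕ, ν' < Nat.find hex → ∃ θ k : ℕ, ∀ (n' : ℕ)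
        (d' : Literature.NumberTheory.EllipticCurves.KolyvaginHeegnerData Dt β ι n') (M' : ℕ),
        Literature.NumberTheory.EllipticCurves.KolyvaginDescent.KolSupp
          (Literature.NumberTheory.EllipticCurves.Zhang2014.IsKolyvaginPrime (W.conductorNorm ℤ) W K 2) n' →
        1 ≤ M' →
        ((θ * M' + k : ℕ) : ℕ∞) ≤ Literature.NumberTheory.EllipticCurves.Zhang2014.levelIndex W 2 n' →
        n'.primeFactors.card = ν' → d'.kolyvaginClass Nat.prime_two M' = 0 := by
      intro ν' hν'
      have h := Nat.find_min hex hν'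
      rw [not_forall] at h
      obtain ⟨θ, h⟩ := h
      rw [not_forall] at h
      obtain ⟨k, hθk⟩ := h
      exact ⟨θ, k, fun n' d' M' hn' hM' hle hcard ↦ by
        by_contra hne'; exact hθk ⟨n', d', M', hn', hcard, hM', hle, hne'⟩⟩
    -- the ONLY use of V2: the lower bound `ν + 1 ≤ max(c, c') = 1` forces `ν = 0`
    have hstruct := hV2 W hCM hred hsur K hK hne3 hne4 h2d hHN Dt β ι (Nat.find hex) hrich hbelow
    have hν : Nat.find hex = 0 := by
      rcases hstruct with h1 | h1 <;> omega
    rw [hν] at hrich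
    obtain ⟨n₀, d₀, M₀, hn₀, hν0, hM₀, -, hne₀⟩ := hrich 0 0
    have hn1 : n₀ = 1 := by
      rw [Finset.card_eq_zero, Nat.primeFactors_eq_empty] at hν0
      rcases hν0 with h0 | h1
      · exact absurd (h0 ▸ hn₀.1) not_squarefree_zero
      · exact h1
    subst hn1
    have hEK : Literature.NumberTheory.EllipticCurves.analyticRankEK W K = 1 :=
      Literature.NumberTheory.EllipticCurves.heegnerSystem_analyticRankEK_eq_one_of_kolyvaginClass_one_ne_zero
        (hGZ W _ K) (hrec _ W K) hK rfl hHN d₀ hne₀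
    rw [Literature.NumberTheory.EllipticCurves.analyticRankEK_eq_add_of hE W K,
      Literature.NumberTheory.EllipticCurves.analyticRank_eq_zero_of_entireLFunction_one_ne_zero _ hL1,
      add_zero] at hEK
    exact hEK


end ClosesReplay

open Summit.BirchSwinnertonDyer.BirchSwinnertonDyer.Theses.KolyvaginRankRigidityAtTwo in
/-- **End to end.** The 2-converse over `K` on corank-one frames (y_K non-torsion), the landed-modulo-print transport U2 and
the route's remaining hypotheses decide the leaf `NonCMTwoConverse` — U1's general-corank content is off this path. -/
theorem nonCMTwoConverse_of_heegnerNonTorsionCorankOne (hY : HeegnerNonTorsionAtTwoCorankOne)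
    (hU2 : FullClassDeepeningAtTwo) (hV2 : KolyvaginCorankLowerBoundAtTwoRich)
    (hR : OffHabitatNonSurjTwoConverse) (hIn : PrintedInputsRankOneAtTwo) (hT : NoTwoTorsionOverK)
    (hf : BFHTwistSupply) (h0 : SimpleZeroTwistSplitAtTwoOfBFH) (hGZK : MultPublishedInputsAtTwo)
    (hMod : NewformOfEllipticCurve) (hHLT : HoffsteinLuoNonvanishingTwist) (hEnt : EntireLFunctionRat) :
    Summit.BirchSwinnertonDyer.BirchSwinnertonDyer.Rank1Residual.NonCMTwoConverse :=
  closes_of_corankOne (strongCorankOne_of_boundedDefectCorankOne (corankOne_of_heegnerNonTorsion hY) hU2)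
    hV2 hR hIn hT hf h0 hGZK hMod hHLT hEnt

end Summit.BirchSwinnertonDyer.BirchSwinnertonDyer.Cruxes.KolyvaginBoundedDefectAtTwo.CorankOneCollapse
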